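import Summits.Ventures.YMGap.Thresholds.ZeroCouplingWilsonLoopAllGroups
import Literature.MathematicalPhysics.QuantumFieldTheory.StrongCouplingActivities
import HarnessLib

/-!
# Rectangular loops in `ℤ^d`: links, sides, plaquette-covering numbers, the rectangle after updating ONE link, and one-link Haar
# resampling of the loop matrix (tools for the universal strong-coupling perimeter law, row type C-PERIMETER-G, part 1 of 3)

Cell `pub-ymgap`, seat ds-1 (gen 16). HONEST FRAMING: elementary LATTICE geometry of straight paths and rectangular loops in `ℤ^d` and
Haar invariance over one link, behind `StrongCouplingPerimeterLawAllGroups` (rectangular Wilson loops are `O(β^{⌈(R+T)/2⌉})`, and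
`O(β^{R+T})` when both sides are `≥ 2`, uniformly over all DLR states, for every compact gauge group). Nothing here is about weak
coupling, the continuum, or the Clay problem. Kernel theorems only, 0 definitions, 0 compute.

## Contents

* Straight paths and loops: `card_lineEdges` (`= n`), ★ `card_loopEdges` (`= 2(R+T)` for `i ≠ j`, `R, T ≥ 1`), `line_add`,
  `line_update_of_not_mem`, ★ `line_update_eq_mul`, ★ `rectangle_update_eq` (after updating ONE link of the loop the rectangle matrix is
  `a·g·b` or `a·g⁻¹·b` with `a, b` free of `g`: every link of the loop is traversed exactly once, the four sides are pairwise disjoint).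
* Covering numbers: `exists_mem_forall_not_mem_plaquetteEdges` (`k` plaquettes with `4k < #Λ` leave a link of `Λ` uncovered);
  for loops with both sides `≥ 2`: `coords_of_mem_loopEdges`, ★ `not_mem_loopEdges_parallel` (no two parallel loop links at unit distance),
  ★ `card_plaquetteEdges_inter_loopEdges_le_two` (a plaquette contains at most TWO links of the loop), ★ `exists_mem_loopEdges_forall_not_mem`
  (`k < R + T` plaquettes leave a link of the `R × T` loop uncovered).
* ★ `integral_update_rectangle` (integrating over one link variable of the loop Haar-averages every function of the loop matrix, whatever
  the other links) and ★ `integral_comp_rectangle_mul_eq` (under `dg_∞` the loop matrix is Haar distributed INDEPENDENTLY of every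
  continuous `Ψ` not seeing one of its links) — the loop analogue of gen 11's `integral_comp_plaquette_mul_eq`.

References (mechanism): K. Osterwalder, E. Seiler, Ann. Phys. 110 (1978) 440, §3 (a polymer with a singly covered bond vanishes);
E. Seiler, *Gauge Theories as a Problem of Constructive QFT and Statistical Mechanics*, LNP 159 (1982), Ch. 2.
-/

noncomputable section

open MeasureTheory ProbabilityTheory Set Filter Topology Finset
open scoped NNReal Nat
open Literature.MathematicalPhysics.QuantumLattice (LGConfig ZdEdge ZdPlaquette plaquetteEdges)
open Literature.MathematicalPhysics.QuantumFieldTheory hiding ZdEdge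
open Literature.MathematicalPhysics.QuantumFieldTheory.AreaLaw (loopEdges lineEdges mem_lineEdges_iff dependsOn_line
  continuous_rectangle integrable_zdHaar_of_continuous)

namespace Summit.Ventures.YMGap.ZeroCouplingSlope

/-! ## 2. Geometry of `ℤ^d`: straight paths and the rectangle after updating ONE link; the loop has `2(R+T)` links -/

section Lines

variable {d : ℕ} {G : Type*} [Group G]

omit [Group G] in
/-- A link whose direction is not `k` is not on a straight path of direction `k`. [folklore] -/
theorem not_mem_lineEdges_of_snd_ne {k : Fin d} {n : ℕ} {y : Literature.Probability.LatticeModels.Site d} {e : ZdEdge d}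
    (h : e.2 ≠ k) : e ∉ lineEdges k n y := fun he => by
  obtain ⟨t, -, rfl⟩ := mem_lineEdges_iff.1 he
  exact h rfl

omit [Group G] in
/-- Along a straight path of direction `k` every other coordinate of the base point is constant. [folklore] -/
theorem apply_eq_of_mem_lineEdges {k l : Fin d} (hl : l ≠ k) {n : ℕ} {y : Literature.Probability.LatticeModels.Site d}
    {e : ZdEdge d} (he : e ∈ lineEdges k n y) : e.1 l = y l := by
  obtain ⟨t, -, rfl⟩ := mem_lineEdges_iff.1 he
  simp [hl]

omit [Group G] in
/-- The `k`-coordinate of the `t`-th link of a straight path of direction `k` from `y` is `y k + t`, `t < n`. [folklore] -/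
theorem apply_self_of_mem_lineEdges {k : Fin d} {n : ℕ} {y : Literature.Probability.LatticeModels.Site d} {e : ZdEdge d}
    (he : e ∈ lineEdges k n y) : ∃ t : ℕ, t < n ∧ e.1 k = y k + t := by
  obtain ⟨t, ht, rfl⟩ := mem_lineEdges_iff.1 he
  exact ⟨t, ht, by simp⟩

omit [Group G] in
/-- A straight path of `n` steps has exactly `n` links. [folklore] -/
theorem card_lineEdges (k : Fin d) (n : ℕ) (y : Literature.Probability.LatticeModels.Site d) : (lineEdges k n y).card = n := by
  induction n generalizing y with
  | zero => simp [lineEdges]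
  | succ n ih =>
    simp only [lineEdges]
    rw [Finset.card_insert_of_notMem, ih]
    intro h
    obtain ⟨t, -, ht⟩ := apply_self_of_mem_lineEdges h
    simp at ht
    omega

/-- Updating a link off the path does not change the path holonomy. [folklore] -/
theorem line_update_of_not_mem {k : Fin d} {n : ℕ} {y : Literature.Probability.LatticeModels.Site d} {e : ZdEdge d}
    (he : e ∉ lineEdges k n y) (U : ZdGaugeConfig d G) (g : G) :
    ZdGaugeConfig.line (Function.update U e g) k n y = U.line k n y :=
  dependsOn_line k n y fun e' he' => by
    rw [Function.update_of_ne]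
    rintro rfl
    exact he (Finset.mem_coe.1 he')

/-- Concatenation of straight paths: `s + t` steps from `y` = `s` steps from `y`, then `t` steps from `y + s e_k`. [folklore] -/
theorem line_add (U : ZdGaugeConfig d G) (k : Fin d) (s t : ℕ) (y : Literature.Probability.LatticeModels.Site d) :
    U.line k (s + t) y = U.line k s y * U.line k t (y + Pi.single k (s : ℤ)) := by
  induction s generalizing y with
  | zero => simp [ZdGaugeConfig.line]
  | succ s ih =>
    rw [Nat.succ_add]
    simp only [ZdGaugeConfig.line]
    rw [ih (y + Pi.single k 1), mul_assoc]
    congr 3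
    rw [add_assoc, ← Pi.single_add]
    congr 2
    push_cast
    ring

/-- ★ **Updating the `t`-th link of a straight path**: the holonomy becomes `(first t links) · g · (last n − t − 1 links)`,
the two outer factors not involving the updated link. [folklore] -/
theorem line_update_eq_mul (U : ZdGaugeConfig d G) (k : Fin d) {n t : ℕ} (ht : t < n)
    (y : Literature.Probability.LatticeModels.Site d) (g : G) :
    ZdGaugeConfig.line (Function.update U (y + Pi.single k (t : ℤ), k) g) k n y =
      U.line k t y * g * U.line k (n - t - 1) (y + Pi.single k ((t : ℤ) + 1)) := by
  set W : ZdGaugeConfig d G := Function.update U (y + Pi.single k (t : ℤ), k) g with hW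
  obtain ⟨r, rfl⟩ : ∃ r, n = t + (r + 1) := ⟨n - t - 1, by omega⟩
  rw [line_add W k t (r + 1) y]
  simp only [ZdGaugeConfig.line]
  have h1 : W.line k t y = U.line k t y := line_update_of_not_mem (fun h => by
    obtain ⟨s, hs, hs'⟩ := apply_self_of_mem_lineEdges h
    simp at hs'
    omega) U g
  have h2 : W (y + Pi.single k (t : ℤ), k) = g := by simp [hW]
  have h3 : W.line k r (y + Pi.single k (t : ℤ) + Pi.single k 1) = U.line k r (y + Pi.single k ((t : ℤ) + 1)) := by
    rw [add_assoc, ← Pi.single_add]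
    refine line_update_of_not_mem (fun h => ?_) U g
    obtain ⟨s, hs, hs'⟩ := apply_self_of_mem_lineEdges h
    simp at hs'
    omega
  rw [h1, h2, h3, show t + (r + 1) - t - 1 = r by omega, mul_assoc]

/-- ★ **The rectangle after updating one of its links is a two-sided translate of `g` or of `g⁻¹`** (`i ≠ j`, `R, T ≥ 1`:
every link of the loop is traversed exactly once; the four sides are pairwise disjoint). [folklore] -/
theorem rectangle_update_eq {x : Literature.Probability.LatticeModels.Site d} {i j : Fin d} (hij : i ≠ j) {R T : ℕ}
    (hR : 1 ≤ R) (hT : 1 ≤ T) {e : ZdEdge d} (he : e ∈ loopEdges x i j R T) (U : ZdGaugeConfig d G) :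
    ∃ a b : G, (∀ g, ZdGaugeConfig.rectangle (Function.update U e g) x i j R T = a * g * b) ∨
      (∀ g, ZdGaugeConfig.rectangle (Function.update U e g) x i j R T = a * g⁻¹ * b) := by
  simp only [loopEdges, Finset.mem_union] at he
  -- membership tests for the four sides
  have hbot : ∀ {e : ZdEdge d}, e ∈ lineEdges i R (x + Pi.single j (T : ℤ)) → e ∉ lineEdges i R x := fun h1 h2 => by
    have a1 := apply_eq_of_mem_lineEdges (Ne.symm hij) h1
    have a2 := apply_eq_of_mem_lineEdges (Ne.symm hij) h2
    rw [a2] at a1; simp at a1; omega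
  have hlr : ∀ {e : ZdEdge d}, e ∈ lineEdges j T (x + Pi.single i (R : ℤ)) → e ∉ lineEdges j T x := fun h1 h2 => by
    have a1 := apply_eq_of_mem_lineEdges hij h1
    have a2 := apply_eq_of_mem_lineEdges hij h2
    rw [a2] at a1; simp at a1; omega
  have hdir_i : ∀ {e : ZdEdge d} {n : ℕ} {y z : Literature.Probability.LatticeModels.Site d} {m : ℕ},
      e ∈ lineEdges i n y → e ∉ lineEdges j m z := fun h =>
    not_mem_lineEdges_of_snd_ne (by obtain ⟨t, -, rfl⟩ := mem_lineEdges_iff.1 h; exact hij)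
  have hdir_j : ∀ {e : ZdEdge d} {n : ℕ} {y z : Literature.Probability.LatticeModels.Site d} {m : ℕ},
      e ∈ lineEdges j n y → e ∉ lineEdges i m z := fun h =>
    not_mem_lineEdges_of_snd_ne (by obtain ⟨t, -, rfl⟩ := mem_lineEdges_iff.1 h; exact Ne.symm hij)
  rcases he with ((h1 | h2) | h3) | h4
  · -- bottom side
    obtain ⟨t, ht, rfl⟩ := mem_lineEdges_iff.1 h1
    refine ⟨U.line i t x, U.line i (R - t - 1) (x + Pi.single i ((t : ℤ) + 1)) *
      U.line j T (x + Pi.single i (R : ℤ)) * (U.line i R (x + Pi.single j (T : ℤ)))⁻¹ * (U.line j T x)⁻¹, Or.inl fun g => ?_⟩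
    simp only [ZdGaugeConfig.rectangle]
    rw [line_update_eq_mul U i ht x g, line_update_of_not_mem (hdir_i h1) U g,
      line_update_of_not_mem (fun h => hbot h h1) U g, line_update_of_not_mem (hdir_i h1) U g]
    simp only [mul_assoc]
  · -- right side
    obtain ⟨t, ht, rfl⟩ := mem_lineEdges_iff.1 h2
    refine ⟨U.line i R x * U.line j t (x + Pi.single i (R : ℤ)),
      U.line j (T - t - 1) (x + Pi.single i (R : ℤ) + Pi.single j ((t : ℤ) + 1)) *
        (U.line i R (x + Pi.single j (T : ℤ)))⁻¹ * (U.line j T x)⁻¹, Or.inl fun g => ?_⟩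
    simp only [ZdGaugeConfig.rectangle]
    rw [line_update_eq_mul U j ht _ g, line_update_of_not_mem (hdir_j h2) U g,
      line_update_of_not_mem (hdir_j h2) U g, line_update_of_not_mem (hlr h2) U g]
    simp only [mul_assoc]
  · -- top side (traversed backwards)
    obtain ⟨t, ht, rfl⟩ := mem_lineEdges_iff.1 h3
    refine ⟨U.line i R x * U.line j T (x + Pi.single i (R : ℤ)) *
        (U.line i (R - t - 1) (x + Pi.single j (T : ℤ) + Pi.single i ((t : ℤ) + 1)))⁻¹,
      (U.line i t (x + Pi.single j (T : ℤ)))⁻¹ * (U.line j T x)⁻¹, Or.inr fun g => ?_⟩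
    simp only [ZdGaugeConfig.rectangle]
    rw [line_update_eq_mul U i ht _ g, line_update_of_not_mem (fun h => hbot h3 h) U g,
      line_update_of_not_mem (hdir_i h3) U g, line_update_of_not_mem (hdir_i h3) U g]
    simp only [mul_inv_rev, mul_assoc]
  · -- left side (traversed backwards)
    obtain ⟨t, ht, rfl⟩ := mem_lineEdges_iff.1 h4
    refine ⟨U.line i R x * U.line j T (x + Pi.single i (R : ℤ)) * (U.line i R (x + Pi.single j (T : ℤ)))⁻¹ *
        (U.line j (T - t - 1) (x + Pi.single j ((t : ℤ) + 1)))⁻¹, (U.line j t x)⁻¹, Or.inr fun g => ?_⟩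
    simp only [ZdGaugeConfig.rectangle]
    rw [line_update_eq_mul U j ht x g, line_update_of_not_mem (hdir_j h4) U g,
      line_update_of_not_mem (fun h => hlr h h4) U g, line_update_of_not_mem (hdir_j h4) U g]
    simp only [mul_inv_rev, mul_assoc]

omit [Group G] in
/-- ★ **The `R × T` loop (`i ≠ j`, `R, T ≥ 1`) has exactly `2(R + T)` links.** [folklore] -/
theorem card_loopEdges {x : Literature.Probability.LatticeModels.Site d} {i j : Fin d} (hij : i ≠ j) {R T : ℕ}
    (hR : 1 ≤ R) (hT : 1 ≤ T) : (loopEdges x i j R T).card = 2 * (R + T) := by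
  have hdisj_ij : ∀ (n m : ℕ) (y z : Literature.Probability.LatticeModels.Site d),
      Disjoint (lineEdges i n y) (lineEdges j m z) := fun n m y z =>
    Finset.disjoint_left.2 fun e h1 h2 =>
      not_mem_lineEdges_of_snd_ne (by obtain ⟨t, -, rfl⟩ := mem_lineEdges_iff.1 h1; exact hij) h2
  have hbot : Disjoint (lineEdges i R x) (lineEdges i R (x + Pi.single j (T : ℤ))) :=
    Finset.disjoint_left.2 fun e h2 h1 => by
      have a1 := apply_eq_of_mem_lineEdges (Ne.symm hij) h1
      have a2 := apply_eq_of_mem_lineEdges (Ne.symm hij) h2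
      rw [a2] at a1; simp at a1; omega
  have hlr : Disjoint (lineEdges j T (x + Pi.single i (R : ℤ))) (lineEdges j T x) :=
    Finset.disjoint_left.2 fun e h1 h2 => by
      have a1 := apply_eq_of_mem_lineEdges hij h1
      have a2 := apply_eq_of_mem_lineEdges hij h2
      rw [a2] at a1; simp at a1; omega
  unfold loopEdges
  rw [Finset.card_union_of_disjoint, Finset.card_union_of_disjoint, Finset.card_union_of_disjoint, card_lineEdges,
    card_lineEdges, card_lineEdges, card_lineEdges]
  · ring
  · exact hdisj_ij _ _ _ _
  · exact Finset.disjoint_union_left.2 ⟨hbot, (hdisj_ij _ _ _ _).symm⟩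
  · exact Finset.disjoint_union_left.2 ⟨Finset.disjoint_union_left.2 ⟨hdisj_ij _ _ _ _, hlr⟩, hdisj_ij _ _ _ _⟩


/-! ### Plaquette-covering numbers of a loop -/

/-- **Counting**: `k` plaquettes cover at most `4k` links, so a family of `k` plaquettes with `4k < #Λ` leaves a link of `Λ` uncovered.
[folklore] -/
theorem exists_mem_forall_not_mem_plaquetteEdges {k : ℕ} (f : Fin k → ZdPlaquette d) {Λ : Finset (ZdEdge d)}
    (h : 4 * k < Λ.card) : ∃ e ∈ Λ, ∀ l, e ∉ plaquetteEdges (f l) := by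
  classical
  by_contra hcon
  push Not at hcon
  have hsub : Λ ⊆ Finset.univ.biUnion fun l => plaquetteEdges (f l) := fun e he => by
    obtain ⟨l, hl⟩ := hcon e he
    exact Finset.mem_biUnion.2 ⟨l, Finset.mem_univ _, hl⟩
  have h4 : ∀ q : ZdPlaquette d, (plaquetteEdges q).card ≤ 4 := fun q => by
    unfold plaquetteEdges; exact Finset.card_le_four
  have h1 := Finset.card_le_card hsub
  have h2 : (Finset.univ.biUnion fun l => plaquetteEdges (f l)).card ≤ 4 * k :=
    calc _ ≤ ∑ l, (plaquetteEdges (f l)).card := Finset.card_biUnion_le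
      _ ≤ ∑ _l : Fin k, 4 := Finset.sum_le_sum fun l _ => h4 (f l)
      _ = 4 * k := by simp [mul_comm]
  omega


/-- **Coordinates of the loop's links**: an `i`-link of the `R × T` loop has all coordinates off `{i, j}` equal to those of `x` and
`j`-coordinate `x j` (bottom) or `x j + T` (top); a `j`-link has `i`-coordinate `x i + R` (right) or `x i` (left). [folklore] -/
theorem coords_of_mem_loopEdges {x z : Literature.Probability.LatticeModels.Site d} {i j κ : Fin d} (hij : i ≠ j) {R T : ℕ}
    (h : (z, κ) ∈ loopEdges x i j R T) :
    (κ = i ∧ (∀ l, l ≠ i → l ≠ j → z l = x l) ∧ (z j = x j ∨ z j = x j + T)) ∨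
      (κ = j ∧ (∀ l, l ≠ i → l ≠ j → z l = x l) ∧ (z i = x i ∨ z i = x i + R)) := by
  simp only [loopEdges, Finset.mem_union] at h
  rcases h with ((h | h) | h) | h
  · obtain ⟨t, -, ht⟩ := mem_lineEdges_iff.1 h
    simp only [Prod.mk.injEq] at ht
    obtain ⟨hz, hκ⟩ := ht
    subst hz
    exact Or.inl ⟨hκ, fun l hl _ => by simp [hl], Or.inl (by simp [hij.symm])⟩
  · obtain ⟨t, -, ht⟩ := mem_lineEdges_iff.1 h
    simp only [Prod.mk.injEq] at ht
    obtain ⟨hz, hκ⟩ := ht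
    subst hz
    exact Or.inr ⟨hκ, fun l hl hl' => by simp [hl, hl'], Or.inr (by simp [hij])⟩
  · obtain ⟨t, -, ht⟩ := mem_lineEdges_iff.1 h
    simp only [Prod.mk.injEq] at ht
    obtain ⟨hz, hκ⟩ := ht
    subst hz
    exact Or.inl ⟨hκ, fun l hl hl' => by simp [hl, hl'], Or.inr (by simp [hij.symm])⟩
  · obtain ⟨t, -, ht⟩ := mem_lineEdges_iff.1 h
    simp only [Prod.mk.injEq] at ht
    obtain ⟨hz, hκ⟩ := ht
    subst hz
    exact Or.inr ⟨hκ, fun l _ hl' => by simp [hl'], Or.inl (by simp [hij])⟩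

/-- ★ **No two parallel links at unit distance on a loop with both sides `≥ 2`**: `(z, κ)` and `(z + e_μ, κ)` (`μ ≠ κ`) cannot both lie on the
`R × T` loop when `i ≠ j` and `R, T ≥ 2` (parallel sides are `T` resp. `R ≥ 2` apart, the other coordinates are frozen). [folklore] -/
theorem not_mem_loopEdges_parallel {x z : Literature.Probability.LatticeModels.Site d} {i j : Fin d} (hij : i ≠ j) {R T : ℕ}
    (hR : 2 ≤ R) (hT : 2 ≤ T) {κ μ : Fin d} (hμκ : μ ≠ κ) (h1 : (z, κ) ∈ loopEdges x i j R T)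
    (h2 : (z + Pi.single μ 1, κ) ∈ loopEdges x i j R T) : False := by
  rcases coords_of_mem_loopEdges hij h1 with ⟨hκ1, hc1, hs1⟩ | ⟨hκ1, hc1, hs1⟩ <;>
    rcases coords_of_mem_loopEdges hij h2 with ⟨hκ2, hc2, hs2⟩ | ⟨hκ2, hc2, hs2⟩
  · have hμi : μ ≠ i := fun h => hμκ (h.trans hκ1.symm)
    by_cases hμj : μ = j
    · subst hμj; simp at hs2; omega
    · have a := hc1 μ hμi hμj; have b := hc2 μ hμi hμj; simp at b; omega
  · exact hij (hκ1.symm.trans hκ2)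
  · exact hij (hκ2.symm.trans hκ1)
  · have hμj : μ ≠ j := fun h => hμκ (h.trans hκ1.symm)
    by_cases hμi : μ = i
    · subst hμi; simp at hs2; omega
    · have a := hc1 μ hμi hμj; have b := hc2 μ hμi hμj; simp at b; omega

/-- ★ **A plaquette contains at most two links of a loop with both sides `≥ 2`** (its two `k`-links are parallel at unit distance, and so
are its two `l`-links: `not_mem_loopEdges_parallel`). [folklore] -/
theorem card_plaquetteEdges_inter_loopEdges_le_two {x : Literature.Probability.LatticeModels.Site d} {i j : Fin d} (hij : i ≠ j)
    {R T : ℕ} (hR : 2 ≤ R) (hT : 2 ≤ T) (q : ZdPlaquette d) : (plaquetteEdges q ∩ loopEdges x i j R T).card ≤ 2 := by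
  classical
  obtain ⟨y, ⟨⟨k, l⟩, hkl⟩⟩ := q
  have hkl' : k ≠ l := ne_of_lt hkl
  set L := loopEdges x i j R T
  -- the two `k`-links and the two `l`-links
  have hsplit : plaquetteEdges (y, ⟨(k, l), hkl⟩) = ({(y, k), (y + Pi.single l 1, k)} : Finset (ZdEdge d)) ∪ {(y + Pi.single k 1, l), (y, l)} := by
    ext e; simp [plaquetteEdges]; tauto
  have hA : (({(y, k), (y + Pi.single l 1, k)} : Finset (ZdEdge d)) ∩ L).card ≤ 1 := by
    refine Finset.card_le_one.2 fun a ha b hb => ?_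
    simp only [Finset.mem_inter, Finset.mem_insert, Finset.mem_singleton] at ha hb
    rcases ha with ⟨rfl | rfl, ha⟩ <;> rcases hb with ⟨rfl | rfl, hb⟩
    · rfl
    · exact (not_mem_loopEdges_parallel hij hR hT hkl'.symm ha hb).elim
    · exact (not_mem_loopEdges_parallel hij hR hT hkl'.symm hb ha).elim
    · rfl
  have hB : (({(y + Pi.single k 1, l), (y, l)} : Finset (ZdEdge d)) ∩ L).card ≤ 1 := by
    refine Finset.card_le_one.2 fun a ha b hb => ?_
    simp only [Finset.mem_inter, Finset.mem_insert, Finset.mem_singleton] at ha hb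
    rcases ha with ⟨rfl | rfl, ha⟩ <;> rcases hb with ⟨rfl | rfl, hb⟩
    · rfl
    · exact (not_mem_loopEdges_parallel hij hR hT hkl' hb ha).elim
    · exact (not_mem_loopEdges_parallel hij hR hT hkl' ha hb).elim
    · rfl
  rw [hsplit, Finset.union_inter_distrib_right]
  exact (Finset.card_union_le _ _).trans (by omega)

/-- **Counting, both sides `≥ 2`**: `k` plaquettes cover at most `2k` links of the loop, so `k < R + T` plaquettes leave a link of the
`R × T` loop uncovered. [folklore] -/
theorem exists_mem_loopEdges_forall_not_mem {x : Literature.Probability.LatticeModels.Site d} {i j : Fin d} (hij : i ≠ j) {R T : ℕ}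
    (hR : 2 ≤ R) (hT : 2 ≤ T) {k : ℕ} (f : Fin k → ZdPlaquette d) (hk : k < R + T) :
    ∃ e ∈ loopEdges x i j R T, ∀ l, e ∉ plaquetteEdges (f l) := by
  classical
  by_contra hcon
  push Not at hcon
  set L := loopEdges x i j R T
  have hsub : L ⊆ Finset.univ.biUnion fun l => plaquetteEdges (f l) ∩ L := fun e he => by
    obtain ⟨l, hl⟩ := hcon e he
    exact Finset.mem_biUnion.2 ⟨l, Finset.mem_univ _, Finset.mem_inter.2 ⟨hl, he⟩⟩
  have h1 := Finset.card_le_card hsub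
  have h2 : (Finset.univ.biUnion fun l => plaquetteEdges (f l) ∩ L).card ≤ 2 * k :=
    calc _ ≤ ∑ l, (plaquetteEdges (f l) ∩ L).card := Finset.card_biUnion_le
      _ ≤ ∑ _l : Fin k, 2 := Finset.sum_le_sum fun l _ => card_plaquetteEdges_inter_loopEdges_le_two hij hR hT (f l)
      _ = 2 * k := by simp [mul_comm]
  have h3 : L.card = 2 * (R + T) := card_loopEdges hij (by omega) (by omega)
  omega

end Lines

/-! ## 3. One-link Haar invariance: under `dg_∞` the loop matrix is Haar distributed independently of anything not seeing one of its links -/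

section Haar

variable {d : ℕ} {G : Type*} [Group G] [TopologicalSpace G] [IsTopologicalGroup G] [CompactSpace G]
  [MeasurableSpace G] [BorelSpace G]

/-- **Haar invariance over one link of the loop**: integrating a function of the rectangle matrix over ONE of the loop's
link variables gives its Haar average (`rectangle_update_eq` and two-sided invariance of Haar measure). [folklore] -/
theorem integral_update_rectangle {E : Type*} [NormedAddCommGroup E] [NormedSpace ℝ E] (Φ : G → E)
    {x : Literature.Probability.LatticeModels.Site d} {i j : Fin d} (hij : i ≠ j) {R T : ℕ} (hR : 1 ≤ R) (hT : 1 ≤ T)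
    {e : ZdEdge d} (he : e ∈ loopEdges x i j R T) (U : ZdGaugeConfig d G) :
    ∫ g, Φ (ZdGaugeConfig.rectangle (Function.update U e g) x i j R T) ∂haarProbability G = ∫ g, Φ g ∂haarProbability G := by
  obtain ⟨a, b, h | h⟩ := rectangle_update_eq hij hR hT he U
  · simp_rw [h]; exact integral_haar_conj_eq Φ a b
  · simp_rw [h]; exact integral_haar_conj_inv_eq Φ a b

variable [SecondCountableTopology G]

/-- ★ **Resampling a link of the loop that `Ψ` ignores**: if `e` is a link of the `R × T` loop (`i ≠ j`, `R, T ≥ 1`) and the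
continuous function `Ψ` does not depend on `U_e`, then under `dg_∞` the loop matrix is Haar distributed INDEPENDENTLY of `Ψ`:
`∫ Φ(U_{R×T}) Ψ dg_∞ = (∫ Φ dHaar) · ∫ Ψ dg_∞` (Fubini over the link `e` and `integral_update_rectangle`). [folklore] -/
theorem integral_comp_rectangle_mul_eq {Φ : G → ℝ} (hΦ : Continuous Φ) {x : Literature.Probability.LatticeModels.Site d}
    {i j : Fin d} (hij : i ≠ j) {R T : ℕ} (hR : 1 ≤ R) (hT : 1 ≤ T) {e : ZdEdge d} (he : e ∈ loopEdges x i j R T)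
    {Ψ : ZdGaugeConfig d G → ℝ} (hΨ : Continuous Ψ) (hΨe : ∀ (U : ZdGaugeConfig d G) (g : G), Ψ (Function.update U e g) = Ψ U) :
    ∫ U, Φ (U.rectangle x i j R T) * Ψ U ∂zdHaar d G = (∫ g, Φ g ∂haarProbability G) * ∫ U, Ψ U ∂zdHaar d G := by
  classical
  have hint : Integrable (fun U : ZdGaugeConfig d G => Φ (U.rectangle x i j R T) * Ψ U) (zdHaar d G) :=
    integrable_zdHaar_of_continuous ((hΦ.comp (continuous_rectangle _ _ _ _ _)).mul hΨ)
  have hupd : ∀ U : ZdGaugeConfig d G,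
      ∫ g, Φ (ZdGaugeConfig.rectangle (Function.update U e g) x i j R T) ∂haarProbability G = ∫ g, Φ g ∂haarProbability G :=
    fun U => integral_update_rectangle Φ hij hR hT he U
  rw [zdHaar, Literature.Probability.LatticeModels.integral_infinitePi_eq_integral_update
    (fun _ : Literature.MathematicalPhysics.QuantumLattice.ZdEdge d => haarProbability G) e hint]
  simp_rw [hΨe, integral_mul_const, hupd]
  rw [integral_const_mul]

end Haar

end Summit.Ventures.YMGap.ZeroCouplingSlope
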